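import Summits.Parity.GeneralizedHardyLittlewood.Theses.LiouvilleShiftedTables
import Summits.Parity.GeneralizedHardyLittlewood.Theorems.DilatedTableChowla.Negative.DilatedTableChowlaOffDiagonal

/-!
# `LargeDilatedTableChowla` (stmt-Parity-14839): two reductions for provers — off-diagonal rows only, and a power saving in the dilation suffices

Support file for the item `LiouvilleShiftedTables.LargeDilatedTableChowla` (route
LiouvilleShiftedTables, support r9; notation `F`, `Foff`, `diagF`, `lhsDiag`, `rows`, `cols` of
`Theorems/DilatedTableChowla/Negative/{DilatedTableChowlaBlocks, DilatedTableChowlaOffDiagonal}`).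

* `of_offDiagonal_band` — it suffices to bound the band functional with `F` replaced by its
  off-diagonal part `Foff` (rows `a ≠ a'`): the weighted diagonal mass over ALL dilations is
  `≤ 12 x²/x^{δ/2}` uniformly in the classes (`Negative.lhsDiag_le`), eventually `≤ x²/(2 (log x)^C)`.
  So all the content is cancellation in `S(a,a') = Σ_b λ(ab+c)λ(a'b+c)` for distinct rows of a class.
* `tail_le_of_dyadic` — abstract bookkeeping: dyadic block bounds `Σ_{Q<q≤2Q} f ≤ M·Q^{-η}` for
  `Q ≥ Q₀` sum to tail bounds `Σ_{Q<q≤N} f ≤ M·Q^{-η}/(1 − 2^{-η})`.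
* `of_dyadic_power_saving` — the planner's remark made exact: a band bound with a POWER SAVING in the
  dilation, `Σ_{Q<q≤2Q, q ≤ x^{δ/2}} q³F(q,u q,v q) ≤ M x² Q^{-η}` for all `Q ≥ (log x)^{K₀}` (`η > 0`,
  `K₀`, `M` of the prover's choosing — the shape a large sieve in the `q`-aspect delivers, Siegel moduli
  below `(log x)^{K₀}` excluded), implies the item with threshold exponent
  `K = max K₀ (⌈(C+1)/η⌉₊)`.

[folklore]
-/

namespace Summit.Parity.GeneralizedHardyLittlewood.Theorems.LargeDilatedTableChowla

open Finset
open Summit.Parity.GeneralizedHardyLittlewood.Theses.LiouvilleShiftedTables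
open Summit.Parity.GeneralizedHardyLittlewood.Theorems.DilatedTableChowla.Negative

/-! ### Off-diagonal rows only -/

/-- The band's weighted diagonal mass is at most the full weighted diagonal functional `lhsDiag`.
[folklore] -/
theorem band_diag_le_lhsDiag (c : ℤ) (δ x A : ℝ) (K : ℕ) (u v : ℕ → ℕ) :
    (∑ q ∈ Finset.Ioc ⌊Real.log x ^ K⌋₊ ⌊x ^ (δ / 2)⌋₊, (q : ℝ) ^ 3 * diagF c x A q (u q) (v q))
      ≤ lhsDiag c δ x A u v := by
  unfold lhsDiag
  refine Finset.sum_le_sum_of_subset_of_nonneg ?_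
    fun q _ _ => mul_nonneg (by positivity) (diagF_nonneg c x A q (u q) (v q))
  intro q hq
  rw [Finset.mem_Ioc] at hq
  exact Finset.mem_Icc.2 ⟨by omega, hq.2⟩

/-- **OFF-DIAGONAL REDUCTION.** If the band functional with `F` replaced by its off-diagonal part
`Foff` (rows `a ≠ a'`) is `≤ x²/(log x)^C` for every `C` (with its own `K`, `x₀`), then
`LargeDilatedTableChowla` holds (same `K`; the diagonal costs `12 x²/x^{δ/2} ≤ x²/(2 (log x)^C)`
eventually, the off-diagonal part at exponent `C+1` costs `≤ x²/(2 (log x)^C)` once `log x ≥ 2`).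
[folklore] -/
theorem of_offDiagonal_band
    (h : ∀ c : ℤ, c ≠ 0 → ∀ δ : ℝ, 0 < δ → δ ≤ 1 / 12 → ∀ C : ℝ, 0 < C → ∃ K : ℕ, ∃ x₀ : ℝ,
      ∀ x : ℝ, x₀ ≤ x → ∀ A : ℝ, x ^ δ ≤ A → A ≤ x ^ (1 / 3 + δ) → ∀ u v : ℕ → ℕ,
        (∑ q ∈ Finset.Ioc ⌊Real.log x ^ K⌋₊ ⌊x ^ (δ / 2)⌋₊, (q : ℝ) ^ 3 * Foff c x A q (u q) (v q))
          ≤ x ^ 2 / Real.log x ^ C) :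
    LargeDilatedTableChowla := by
  intro c hc δ hδ hδ' C hC
  obtain ⟨K, x₁, hx₁⟩ := h c hc δ hδ hδ' (C + 1) (by linarith)
  obtain ⟨x₂, hx₂⟩ := eventually_log_rpow_le 24 C (half_pos hδ)
  refine ⟨K, max (max x₁ x₂) (Real.exp 2), fun x hx A hA1 hA2 u v => ?_⟩
  have hx1 : x₁ ≤ x := le_trans (le_trans (le_max_left _ _) (le_max_left _ _)) hx
  have hx2 : x₂ ≤ x := le_trans (le_trans (le_max_right _ _) (le_max_left _ _)) hx
  have hxe : Real.exp 2 ≤ x := le_trans (le_max_right _ _) hx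
  have hlog2 : (2 : ℝ) ≤ Real.log x := (Real.le_log_iff_exp_le ((Real.exp_pos 2).trans_le hxe)).2 hxe
  have hlogpos : 0 < Real.log x := by linarith
  have hx1' : (1 : ℝ) ≤ x := le_trans (by have := Real.add_one_le_exp (2 : ℝ); linarith) hxe
  have hxpos : 0 < x := by linarith
  have hLC : 0 < Real.log x ^ C := Real.rpow_pos_of_pos hlogpos C
  have hxd2 : 0 < x ^ (δ / 2) := Real.rpow_pos_of_pos hxpos _
  -- split F = diagF + Foff termwise
  have hsplit : (∑ q ∈ Finset.Ioc ⌊Real.log x ^ K⌋₊ ⌊x ^ (δ / 2)⌋₊, (q : ℝ) ^ 3 * F c x A q (u q) (v q))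
      = (∑ q ∈ Finset.Ioc ⌊Real.log x ^ K⌋₊ ⌊x ^ (δ / 2)⌋₊, (q : ℝ) ^ 3 * diagF c x A q (u q) (v q)) +
        ∑ q ∈ Finset.Ioc ⌊Real.log x ^ K⌋₊ ⌊x ^ (δ / 2)⌋₊, (q : ℝ) ^ 3 * Foff c x A q (u q) (v q) := by
    rw [← Finset.sum_add_distrib]
    refine Finset.sum_congr rfl fun q _ => ?_
    rw [F_eq_diag_add_off]; ring
  -- diagonal part
  have hd : (∑ q ∈ Finset.Ioc ⌊Real.log x ^ K⌋₊ ⌊x ^ (δ / 2)⌋₊, (q : ℝ) ^ 3 * diagF c x A q (u q) (v q))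
      ≤ x ^ 2 / (2 * Real.log x ^ C) := by
    refine ((band_diag_le_lhsDiag c δ x A K u v).trans
      (lhsDiag_le (c := c) hδ hδ' hx1' hA1 hA2 u v)).trans ?_
    rw [div_le_div_iff₀ hxd2 (by positivity)]
    have : 12 * x ^ 2 * (2 * Real.log x ^ C) = x ^ 2 * (24 * Real.log x ^ C) := by ring
    rw [this]
    gcongr
    exact hx₂ x hx2
  -- off-diagonal part
  have ho : (∑ q ∈ Finset.Ioc ⌊Real.log x ^ K⌋₊ ⌊x ^ (δ / 2)⌋₊, (q : ℝ) ^ 3 * Foff c x A q (u q) (v q))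
      ≤ x ^ 2 / (2 * Real.log x ^ C) := by
    refine (hx₁ x hx1 A hA1 hA2 u v).trans ?_
    rw [Real.rpow_add_one hlogpos.ne' C]
    apply div_le_div_of_nonneg_left (by positivity) (by positivity)
    nlinarith
  have : x ^ 2 / (2 * Real.log x ^ C) + x ^ 2 / (2 * Real.log x ^ C) = x ^ 2 / Real.log x ^ C := by
    field_simp; ring
  change (∑ q ∈ Finset.Ioc ⌊Real.log x ^ K⌋₊ ⌊x ^ (δ / 2)⌋₊, (q : ℝ) ^ 3 * F c x A q (u q) (v q))
    ≤ x ^ 2 / Real.log x ^ C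
  rw [hsplit]
  linarith

/-! ### A power saving in the dilation suffices -/

/-- DYADIC TO TAIL (abstract): if `f ≥ 0` and `Σ_{Q < q ≤ 2Q} f q ≤ M · Q^{-η}` for every `Q ≥ Q₀ ≥ 1`
(`M ≥ 0`, `η > 0`), then `Σ_{Q < q ≤ N} f q ≤ M · Q^{-η} / (1 − 2^{-η})` for every `Q ≥ Q₀` and
every `N` (geometric series over the dyadic blocks `(2^j Q, 2^{j+1} Q]`). [folklore] -/
theorem tail_le_of_dyadic {f : ℕ → ℝ} (hf : ∀ q, 0 ≤ f q) {Q₀ : ℕ} (hQ₀ : 1 ≤ Q₀) {M η : ℝ}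
    (hM : 0 ≤ M) (hη : 0 < η)
    (hdy : ∀ Q : ℕ, Q₀ ≤ Q → ∑ q ∈ Finset.Ioc Q (2 * Q), f q ≤ M * (Q : ℝ) ^ (-η))
    {Q : ℕ} (hQ : Q₀ ≤ Q) (N : ℕ) :
    ∑ q ∈ Finset.Ioc Q N, f q ≤ M * (Q : ℝ) ^ (-η) / (1 - (2 : ℝ) ^ (-η)) := by
  -- the ratio r = 2^{-η} ∈ (0,1)
  set r : ℝ := (2 : ℝ) ^ (-η) with hr
  have hr0 : 0 < r := Real.rpow_pos_of_pos (by norm_num) _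
  have hr1 : r < 1 := Real.rpow_lt_one_of_one_lt_of_neg (by norm_num) (by linarith)
  have h1r : 0 < 1 - r := by linarith
  -- induction on the number of dyadic steps needed to pass N
  suffices key : ∀ k : ℕ, ∀ Q : ℕ, Q₀ ≤ Q → N ≤ 2 ^ k * Q →
      ∑ q ∈ Finset.Ioc Q N, f q ≤ M * (Q : ℝ) ^ (-η) / (1 - r) by
    have hQ1 : 1 ≤ Q := hQ₀.trans hQ
    refine key N Q hQ ?_
    calc N ≤ 2 ^ N := Nat.lt_two_pow_self.le
      _ ≤ 2 ^ N * Q := Nat.le_mul_of_pos_right _ hQ1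
  intro k
  induction k with
  | zero =>
      intro Q hQ hN
      have hQpos : (0 : ℝ) < Q := by exact_mod_cast hQ₀.trans hQ
      have hempty : Finset.Ioc Q N = ∅ := by
        rw [Finset.Ioc_eq_empty_iff]; omega
      rw [hempty, Finset.sum_empty]
      exact div_nonneg (mul_nonneg hM (Real.rpow_pos_of_pos hQpos _).le) h1r.le
  | succ k ih =>
      intro Q hQ hN
      have hQpos : (0 : ℝ) < Q := by exact_mod_cast hQ₀.trans hQ
      have h2Q : Q₀ ≤ 2 * Q := hQ.trans (by omega)
      have hN' : N ≤ 2 ^ k * (2 * Q) := by rw [pow_succ] at hN; linarith [hN]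
      have hsub : Finset.Ioc Q N ⊆ Finset.Ioc Q (2 * Q) ∪ Finset.Ioc (2 * Q) N := by
        intro q hq
        rw [Finset.mem_Ioc] at hq
        rw [Finset.mem_union, Finset.mem_Ioc, Finset.mem_Ioc]
        omega
      have hdisj : Disjoint (Finset.Ioc Q (2 * Q)) (Finset.Ioc (2 * Q) N) := by
        rw [Finset.disjoint_left]
        intro q h1 h2
        rw [Finset.mem_Ioc] at h1 h2
        omega
      have hstep := hdy Q hQ
      have htail := ih (2 * Q) h2Q hN'
      -- (2Q)^{-η} = r · Q^{-η}
      have hmul : (((2 * Q : ℕ) : ℝ)) ^ (-η) = r * (Q : ℝ) ^ (-η) := by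
        push_cast
        rw [Real.mul_rpow (by norm_num) hQpos.le]
      rw [hmul] at htail
      calc ∑ q ∈ Finset.Ioc Q N, f q
          ≤ ∑ q ∈ Finset.Ioc Q (2 * Q) ∪ Finset.Ioc (2 * Q) N, f q :=
            Finset.sum_le_sum_of_subset_of_nonneg hsub fun q _ _ => hf q
        _ = (∑ q ∈ Finset.Ioc Q (2 * Q), f q) + ∑ q ∈ Finset.Ioc (2 * Q) N, f q :=
            Finset.sum_union hdisj
        _ ≤ M * (Q : ℝ) ^ (-η) + M * (r * (Q : ℝ) ^ (-η)) / (1 - r) := add_le_add hstep htail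
        _ = M * (Q : ℝ) ^ (-η) / (1 - r) := by
            field_simp
            ring

/-- **A POWER SAVING IN THE DILATION SUFFICES** (the planner's "a band bound `Σ_{q∼Q} q³F ≪ x²·Q^{-η}`
takes `K = ⌈(C+1)/η⌉`", made exact). Suppose that for some `η > 0`, for every `c ≠ 0` and
`0 < δ ≤ 1/12` there are `K₀`, `M ≥ 0`, `x₀` such that for `x ≥ x₀`, every `A` in the window, all
classes and every natural `Q ≥ (log x)^{K₀}` the dyadic block of band dilations satisfies
`Σ_{Q < q ≤ 2Q, q ≤ x^{δ/2}} q³ F(q,u q,v q) ≤ M · x² · Q^{-η}`. Then `LargeDilatedTableChowla` holds,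
with threshold exponent `K = max (K₀+1) ⌈(C+1)/η⌉₊`: the tail beyond `m = ⌊(log x)^K⌋ ≥ (log x)^K/2`
is `≤ M x² m^{-η}/(1−2^{-η}) ≤ [2^η M/(1−2^{-η})] · x²/(log x)^{C+1} ≤ x²/(log x)^C` for large `x`
(`tail_le_of_dyadic`). [folklore] -/
theorem of_dyadic_power_saving {η : ℝ} (hη : 0 < η)
    (h : ∀ c : ℤ, c ≠ 0 → ∀ δ : ℝ, 0 < δ → δ ≤ 1 / 12 → ∃ K₀ : ℕ, ∃ M : ℝ, 0 ≤ M ∧ ∃ x₀ : ℝ,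
      ∀ x : ℝ, x₀ ≤ x → ∀ A : ℝ, x ^ δ ≤ A → A ≤ x ^ (1 / 3 + δ) → ∀ u v : ℕ → ℕ,
        ∀ Q : ℕ, Real.log x ^ K₀ ≤ Q →
          (∑ q ∈ (Finset.Ioc Q (2 * Q)).filter (fun q : ℕ => q ≤ ⌊x ^ (δ / 2)⌋₊),
              (q : ℝ) ^ 3 * F c x A q (u q) (v q)) ≤ M * x ^ 2 * (Q : ℝ) ^ (-η)) :
    LargeDilatedTableChowla := by
  intro c hc δ hδ hδ' C hC
  obtain ⟨K₀, M, hM, x₀, hx₀⟩ := h c hc δ hδ hδ'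
  -- constants
  set r : ℝ := (2 : ℝ) ^ (-η) with hr
  have hr0 : 0 < r := Real.rpow_pos_of_pos (by norm_num) _
  have hr1 : r < 1 := Real.rpow_lt_one_of_one_lt_of_neg (by norm_num) (by linarith)
  have h1r : 0 < 1 - r := by linarith
  have h2η : 0 < (2 : ℝ) ^ η := Real.rpow_pos_of_pos (by norm_num) η
  set K₁ : ℕ := ⌈(C + 1) / η⌉₊ with hK₁
  set K : ℕ := max (K₀ + 1) K₁ with hKdef
  -- the constant absorbed by one power of `log x`
  set B : ℝ := (2 : ℝ) ^ η * M / (1 - r) with hB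
  have hB0 : 0 ≤ B := div_nonneg (mul_nonneg h2η.le hM) h1r.le
  refine ⟨K, max (max x₀ (Real.exp 2)) (Real.exp B), fun x hx A hA1 hA2 u v => ?_⟩
  have hxx₀ : x₀ ≤ x := le_trans (le_trans (le_max_left _ _) (le_max_left _ _)) hx
  have hxe2 : Real.exp 2 ≤ x := le_trans (le_trans (le_max_right _ _) (le_max_left _ _)) hx
  have hxeB : Real.exp B ≤ x := le_trans (le_max_right _ _) hx
  have hxpos : 0 < x := (Real.exp_pos 2).trans_le hxe2
  have hlog2 : (2 : ℝ) ≤ Real.log x := (Real.le_log_iff_exp_le hxpos).2 hxe2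
  have hlogB : B ≤ Real.log x := (Real.le_log_iff_exp_le hxpos).2 hxeB
  have hlog1 : (1 : ℝ) ≤ Real.log x := by linarith
  have hlogpos : 0 < Real.log x := by linarith
  have hLC : 0 < Real.log x ^ C := Real.rpow_pos_of_pos hlogpos C
  -- the truncated summand `f`
  set Qx : ℕ := ⌊x ^ (δ / 2)⌋₊ with hQx
  set f : ℕ → ℝ := fun q => if q ≤ Qx then (q : ℝ) ^ 3 * F c x A q (u q) (v q) else 0 with hf
  have hf0 : ∀ q, 0 ≤ f q := fun q => by
    simp only [hf]
    split_ifs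
    · exact term_nonneg c x A q (u q) (v q)
    · exact le_rfl
  have hfsum : ∀ s : Finset ℕ, ∑ q ∈ s, f q =
      ∑ q ∈ s.filter (fun q : ℕ => q ≤ Qx), (q : ℝ) ^ 3 * F c x A q (u q) (v q) := fun s => by
    rw [Finset.sum_filter]
  -- dyadic hypothesis for `f` beyond `Q₀ := ⌊(log x)^{K₀}⌋₊ + 1 > (log x)^{K₀}`
  set Q₀ : ℕ := ⌊Real.log x ^ K₀⌋₊ + 1 with hQ₀
  have hQ₀1 : 1 ≤ Q₀ := Nat.le_add_left 1 _
  have hLK₀ : 0 ≤ Real.log x ^ K₀ := pow_nonneg hlogpos.le _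
  have hdy : ∀ Q : ℕ, Q₀ ≤ Q → ∑ q ∈ Finset.Ioc Q (2 * Q), f q ≤ (M * x ^ 2) * (Q : ℝ) ^ (-η) := by
    intro Q hQ
    rw [hfsum]
    refine hx₀ x hxx₀ A hA1 hA2 u v Q ?_
    have h1 : Real.log x ^ K₀ < (Q₀ : ℝ) := by
      rw [hQ₀]; push_cast; exact Nat.lt_floor_add_one _
    have h2 : ((Q₀ : ℕ) : ℝ) ≤ Q := by exact_mod_cast hQ
    exact (h1.trans_le h2).le
  -- the band is a tail of `f` starting at `m = ⌊(log x)^K⌋₊ ≥ Q₀`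
  set m : ℕ := ⌊Real.log x ^ K⌋₊ with hm
  have hKK₀ : K₀ + 1 ≤ K := le_max_left _ _
  have hKK₁ : K₁ ≤ K := le_max_right _ _
  have hLK : Real.log x ^ K₀ + 1 ≤ Real.log x ^ K := by
    have h1 : Real.log x ^ (K₀ + 1) ≤ Real.log x ^ K := pow_le_pow_right₀ hlog1 hKK₀
    have h2 : Real.log x ^ K₀ * 2 ≤ Real.log x ^ (K₀ + 1) := by
      rw [pow_succ]; exact mul_le_mul_of_nonneg_left hlog2 hLK₀
    have h3 : (1 : ℝ) ≤ Real.log x ^ K₀ := one_le_pow₀ hlog1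
    linarith
  have hmQ₀ : Q₀ ≤ m := by
    rw [hQ₀, hm, ← Nat.floor_add_one hLK₀]
    exact Nat.floor_le_floor hLK
  have hband_eq : (∑ q ∈ Finset.Ioc m Qx, (q : ℝ) ^ 3 * F c x A q (u q) (v q))
      = ∑ q ∈ Finset.Ioc m Qx, f q := by
    refine Finset.sum_congr rfl fun q hq => ?_
    rw [Finset.mem_Ioc] at hq
    simp only [hf, if_pos hq.2]
  have htail := tail_le_of_dyadic hf0 hQ₀1 (mul_nonneg hM (sq_nonneg x)) hη hdy hmQ₀ Qx
  -- `m ≥ (log x)^K / 2`, so `m^{-η} ≤ 2^η (log x)^{-Kη} ≤ 2^η (log x)^{-(C+1)}`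
  have hLKpos : 0 < Real.log x ^ K := pow_pos hlogpos K
  have hm_ge : Real.log x ^ K / 2 ≤ (m : ℝ) := by
    have h1 : Real.log x ^ K < (m : ℝ) + 1 := Nat.lt_floor_add_one _
    have h2 : (2 : ℝ) ≤ Real.log x ^ K := by
      calc (2 : ℝ) ≤ Real.log x := hlog2
        _ = Real.log x ^ 1 := (pow_one _).symm
        _ ≤ Real.log x ^ K := pow_le_pow_right₀ hlog1 (le_trans (Nat.le_add_left 1 K₀) hKK₀)
    linarith
  have hmpos : (0 : ℝ) < m := lt_of_lt_of_le (by positivity) hm_ge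
  have hm_rpow : (m : ℝ) ^ (-η) ≤ (2 : ℝ) ^ η * (Real.log x ^ C * Real.log x)⁻¹ := by
    calc (m : ℝ) ^ (-η) ≤ (Real.log x ^ K / 2) ^ (-η) :=
          Real.rpow_le_rpow_of_nonpos (by positivity) hm_ge (by linarith)
      _ = (Real.log x ^ K) ^ (-η) / (2 : ℝ) ^ (-η) := Real.div_rpow hLKpos.le (by norm_num) _
      _ = (2 : ℝ) ^ η * (Real.log x ^ K) ^ (-η) := by
          rw [Real.rpow_neg (by norm_num : (0 : ℝ) ≤ 2) η]
          field_simp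
      _ ≤ (2 : ℝ) ^ η * (Real.log x ^ C * Real.log x)⁻¹ := by
          refine mul_le_mul_of_nonneg_left ?_ h2η.le
          -- `((log x)^K)^{-η} = (log x)^{-(K η)} ≤ (log x)^{-(C+1)} = ((log x)^C log x)⁻¹`
          have e1 : (Real.log x ^ K) ^ (-η) = Real.log x ^ ((K : ℝ) * (-η)) :=
            (Real.rpow_natCast_mul hlogpos.le K (-η)).symm
          have e2 : (Real.log x ^ C * Real.log x)⁻¹ = Real.log x ^ (-(C + 1)) := by
            rw [Real.rpow_neg hlogpos.le, Real.rpow_add_one hlogpos.ne' C]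
          rw [e1, e2]
          refine Real.rpow_le_rpow_of_exponent_le hlog1 ?_
          -- `-(K η) ≤ -(C+1)` ⟸ `C + 1 ≤ K η` ⟸ `(C+1)/η ≤ K₁ ≤ K`
          have hK₁r : (C + 1) / η ≤ (K₁ : ℝ) := Nat.le_ceil _
          have hKr : ((K₁ : ℕ) : ℝ) ≤ (K : ℝ) := by exact_mod_cast hKK₁
          have : C + 1 ≤ (K : ℝ) * η := by
            rw [div_le_iff₀ hη] at hK₁r
            nlinarith
          linarith
  -- assemble
  calc (∑ q ∈ Finset.Ioc m Qx, (q : ℝ) ^ 3 * F c x A q (u q) (v q))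
      = ∑ q ∈ Finset.Ioc m Qx, f q := hband_eq
    _ ≤ M * x ^ 2 * (m : ℝ) ^ (-η) / (1 - r) := htail
    _ ≤ M * x ^ 2 * ((2 : ℝ) ^ η * (Real.log x ^ C * Real.log x)⁻¹) / (1 - r) := by
        gcongr
    _ = B * (x ^ 2 / (Real.log x ^ C * Real.log x)) := by
        rw [hB]; field_simp
    _ ≤ Real.log x * (x ^ 2 / (Real.log x ^ C * Real.log x)) :=
        mul_le_mul_of_nonneg_right hlogB (by positivity)
    _ = x ^ 2 / Real.log x ^ C := by
        field_simp

end Summit.Parity.GeneralizedHardyLittlewood.Theorems.LargeDilatedTableChowla
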